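import Summits.NavierStokesRegularity.NavierStokesRegularity.Theses.AdiabaticEddy
import Literature.Analysis.FluidPDE.WholeSpaceIBP
import Literature.Analysis.FluidPDE.ClassicalSolutionCalculus

/-!
# Line `SketchIdeator1` (card `shell-balance-edge-torsion`) for crux `NoFrozenEddyCollapse`
  (stmt-NavierStokesRegularity-1431) of route `AdiabaticEddy` — gen 1 (lead reshape of the ideator sketch)

The crux (`Summit.NavierStokesRegularity.NavierStokesRegularity.Theses.AdiabaticEddy.NoFrozenEddyCollapse`):
for every classical NS solution `u` on `ℝ³ × [0,T)` (Leray–Hopf from a rapidly decaying datum), every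
smooth compactly supported steady Euler flow `U` (`U·∇U + ∇P = 0`, `div U = 0`), every `α ∈ (1/2,3/4)`,
`ℓ > 0` and centre path `ξ`: if `(T−t)^α u(t, ξ(t) + ℓ√(ν(T−t)) y) → U(y)` locally uniformly as
`t ↑ T`, then `U = 0`.

## The line

Test the momentum equation, in the eddy frame `y = (x − ξ(t))/L(t)`, `L = ℓ√(ν(T−t))`,
`V(t,y) = (T−t)^α u(t, ξ(t) + L y)`, against the EXACT COKERNEL of the linearised steady Euler operator at
`U`: the fields `φ_f = f(B)U` and `ψ_g = g(B) curl U`, `B = P + |U|²/2` the Bernoulli head.  For such a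
`φ` (smooth, compactly supported, divergence free, and `∫ ⟪U, Dφ·W⟫ + ⟪W, Dφ·U⟫ = 0` for every `C¹`
divergence-free `W` — `stub_cokernelEnergy`, `stub_cokernelHelicity`) the WINDOW LAW (`stub_windowLaw`) reads
`d/dt ⟨V(t), φ⟩ = q(t) + (ℓ(T−t))⁻¹ ⟨V(t), 𝓛*φ⟩`, `𝓛*φ = ℓ⁻¹Δφ − αℓφ + (ℓ/2)(3φ + Dφ·y)`, with a
remainder `|q(t)| ≤ K_φ ρ(t)`, `ρ(t) = (A/L)‖V−U‖²_{L²(B_R)} + (|ξ̇|/L)‖V−U‖_{L²(B_R)}` (`A = (T−t)^{−α}`):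
no linear fluctuation term, no pressure, the frame enters only through the quadratic/frame remainder.
On a QUIET frame (`stub_quietFrame`: the crux's rate gap, honestly named — a `C¹` centre path along which
`ρ` is integrable up to `T`) the abstract LOG-WINDOW lemma (`stub_logWindow`: `G` bounded,
`G′ = q + c/(ℓ(T−t))`, `q` dominated by an integrable weight, `c → c₀` force `c₀ = 0`, because
`∫ dt/(T−t) = ∞`) and the convergence of pairings (`stub_pairingLimit`) give `⟨U, 𝓛*φ⟩ = 0`; the adjoint
identity (`integral_inner_adjointDrift`, PROVED below) turns this into the Bernoulli-SHELL BALANCES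
`⟨ΔU − αℓ²U − (ℓ²/2)DU·y, f(B)U⟩ = 0`, `⟨…, g(B)curl U⟩ = 0` for all smooth `f, g`; and the Euler-side
rigidity `stub_noShellBalance` (the card's FIRST LEMMA, edge torsion) gives `U = 0`.

## Reshape relative to the ideator sketch (`Cruxes/NoFrozenEddyCollapse/SketchIdeator1.lean`)

* signatures in TREE VOCABULARY ONLY (`bernoulli`, `frozenDrift`, `adjointDrift`, `rescaled`, `IsQuiet`
  unfolded), so every stub helper file under `Theorems/` imports `Literature.*` + Mathlib only;
* the sketch's `WindowLaw` had no frame term; centring kills `⟨W ⊗ ξ̇/L, ∇φ⟩` only for `φ = U` (ideator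
  notes §2).  Here the frame term is part of the remainder `q`, and the rate-gap stub `stub_quietFrame`
  asks for integrability of `ρ`, which contains the frame part `(|ξ̇|/L)‖V−U‖` (for a centred frame the
  modulation equation gives `|ξ̇| ≲ A(‖V−U‖ + √ν(T−t)^{α−1/2})`, whose frame part is then integrable iff
  `α > 1/2` — the only place `α > 1/2` enters the quiet branch);
* `Recentre` (IFT centring) is folded into `stub_quietFrame` (∃ a C¹ frame), since any `C¹` path
  `o(L)`-close to `ξ` keeps the convergence and only the integrability of `ρ` is ever used;
* the composition `NoFrozenEddyCollapse_of` is kernel-checked (no `sorry` outside the seven stubs).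

Hypotheses each stub genuinely uses are recorded in its docstring (for the standing disprover).
-/

noncomputable section

open MeasureTheory Set Filter Topology Metric Function
open scoped InnerProductSpace

namespace Summit.NavierStokesRegularity.NavierStokesRegularity.Cruxes.NoFrozenEddyCollapse.ShellBalanceEdgeTorsion

open Literature.Analysis.FluidPDE

set_option linter.unusedVariables false

/-! ### The seven registered stubs (tree vocabulary only) -/

/-- **Stub 1 — QUIET FRAME (the rate gap of the crux, NS side; research-level).**  Under the hypotheses
of the crux with `U ≠ 0` there is a `C¹` centre path `ξ'` on some `(T₀, T)`, `0 ≤ T₀ < T`, along which the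
rescaled field still converges to `U` locally uniformly, and a radius `R` with `tsupport U ⊆ B_R`, such
that the QUIET WEIGHT
`ρ(t) = (T−t)^{−α}/L(t) · ∫_{B_R} ‖V'(t) − U‖² + ‖ξ̇'(t)‖/L(t) · (∫_{B_R} ‖V'(t) − U‖²)^{1/2}`,
`L(t) = ℓ√(ν(T−t))`, `V'(t,y) = (T−t)^α u(t, ξ'(t) + L(t) y)`, is integrable on `(T₀, T)`.
Intended route: IFT centring `∫ ⟪V'(t) − U, ∂ⱼU⟫ = 0` (Gram matrix `∫ ∂ⱼU·∂ₖU ≻ 0` for compactly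
supported `U ≠ 0`), the modulation bound `|ξ̇'| ≲ (T−t)^{−α}(‖V'−U‖_{L²(B_R)} + √ν (T−t)^{α−1/2})`
(from `d/dt` of the centring identity and the window law with `φ = ∂ⱼU`), which makes the frame part of
`ρ` integrable iff `α > 1/2` GIVEN the energy part; and the energy part
`∫^T (T−t)^{−α}/L · ‖V'−U‖²_{L²(B_R)} dt < ∞` — relative `L²` accuracy `o(Re^{-1/2})` in log-average —
which is NOT derivable from rate-free `C⁰` convergence by any argument known to the ideator or the lead
(locked noise fed by exterior tidal pressure is formally consistent).  This stub is where the line meets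
the crux's real difficulty; it cannot be refuted without an actual blow-up solution.
Uses: everything in the crux.  Size: XL / open. -/
theorem stub_quietFrame :
    ∀ (ν T : ℝ) (u : ℝ → EuclideanSpace ℝ (Fin 3) → EuclideanSpace ℝ (Fin 3))
      (p : ℝ → EuclideanSpace ℝ (Fin 3) → ℝ)
      (U : EuclideanSpace ℝ (Fin 3) → EuclideanSpace ℝ (Fin 3)) (P : EuclideanSpace ℝ (Fin 3) → ℝ)
      (α ℓ : ℝ) (ξ : ℝ → EuclideanSpace ℝ (Fin 3)),
      0 < ν → 0 < T →
      IsClassicalNSSolutionOn (Set.Ico 0 T) ν 0 u p → IsLerayHopfOn T ν 0 (u 0) u →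
      HasRapidSpatialDecay (u 0) →
      ContDiff ℝ (⊤ : ℕ∞) U → ContDiff ℝ (⊤ : ℕ∞) P → HasCompactSupport U →
      VectorCalculus.IsDivFree U → (∀ x, convect U U x + gradient P x = 0) → U ≠ 0 →
      α ∈ Set.Ioo (1 / 2 : ℝ) (3 / 4) → 0 < ℓ →
      TendstoLocallyUniformly (fun (t : ℝ) (y : EuclideanSpace ℝ (Fin 3)) =>
        ((T - t) ^ α) • u t (ξ t + (ℓ * Real.sqrt (ν * (T - t))) • y)) U (nhdsWithin T (Set.Iio T)) →
      ∃ (T₀ R : ℝ) (ξ' dξ' : ℝ → EuclideanSpace ℝ (Fin 3)), 0 ≤ T₀ ∧ T₀ < T ∧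
        (∀ t ∈ Set.Ioo T₀ T, HasDerivAt ξ' (dξ' t) t) ∧ ContinuousOn dξ' (Set.Ioo T₀ T) ∧
        TendstoLocallyUniformly (fun (t : ℝ) (y : EuclideanSpace ℝ (Fin 3)) =>
          ((T - t) ^ α) • u t (ξ' t + (ℓ * Real.sqrt (ν * (T - t))) • y)) U (nhdsWithin T (Set.Iio T)) ∧
        tsupport U ⊆ Metric.ball 0 R ∧
        IntegrableOn (fun t : ℝ =>
          (T - t) ^ (-α) / (ℓ * Real.sqrt (ν * (T - t))) *
              (∫ y in Metric.ball (0 : EuclideanSpace ℝ (Fin 3)) R,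
                ‖((T - t) ^ α) • u t (ξ' t + (ℓ * Real.sqrt (ν * (T - t))) • y) - U y‖ ^ 2) +
            ‖dξ' t‖ / (ℓ * Real.sqrt (ν * (T - t))) *
              Real.sqrt (∫ y in Metric.ball (0 : EuclideanSpace ℝ (Fin 3)) R,
                ‖((T - t) ^ α) • u t (ξ' t + (ℓ * Real.sqrt (ν * (T - t))) • y) - U y‖ ^ 2))
          (Set.Ioo T₀ T) := by
  sorry

/-- **Stub 2 — NO SHELL BALANCE (the card's FIRST LEMMA, Euler side; research-level).**  No nonzero
smooth compactly supported steady Euler flow `(U, P)` satisfies both families of Bernoulli-shell balances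
`∫ ⟪ΔU − αℓ²U − (ℓ²/2) DU·y, f(P + |U|²/2) U⟫ = 0` (energy, all smooth `f`) and
`∫ ⟪ΔU − αℓ²U − (ℓ²/2) DU·y, g(P + |U|²/2) curl U⟫ = 0` (helicity, all smooth `g`) for any
`α ∈ (1/2, 3/4)`, `ℓ > 0`.  Proposed proof (card): EDGE TORSION at the flat compact edge of `tsupport U`
— the energy family forces the direction of `U` to rotate across the edge leaves at rate `|A′/A|`
(`c² → 1`), the helicity family forces `c′ = −L(c + c³)`, i.e. `c ≡ 0` near the edge; Beltrami edge pockets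
die by sign (`λ² = −ℓ²(α − 1/2)`).  Open sub-cases flagged by the ideator: pinched edges (leaves with
stagnation points), the no-sloshing step (Arnold normal form on edge tori), regular flatness.
Uses: `HasCompactSupport U`, `ContDiff ⊤ U` (flat edge) essentially; `α > 1/2` only through signs.
Size: L / open. -/
theorem stub_noShellBalance :
    ∀ α ∈ Set.Ioo (1 / 2 : ℝ) (3 / 4), ∀ ℓ : ℝ, 0 < ℓ →
      ∀ (U : EuclideanSpace ℝ (Fin 3) → EuclideanSpace ℝ (Fin 3)) (P : EuclideanSpace ℝ (Fin 3) → ℝ),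
        ContDiff ℝ (⊤ : ℕ∞) U → ContDiff ℝ (⊤ : ℕ∞) P → HasCompactSupport U →
        VectorCalculus.IsDivFree U → (∀ x, convect U U x + gradient P x = 0) →
        (∀ f : ℝ → ℝ, ContDiff ℝ (⊤ : ℕ∞) f →
          ∫ y, inner ℝ (Laplacian.laplacian U y - (α * ℓ ^ 2) • U y - (ℓ ^ 2 / 2) • (fderiv ℝ U y) y)
              (f (P y + ‖U y‖ ^ 2 / 2) • U y) = 0) →
        (∀ g : ℝ → ℝ, ContDiff ℝ (⊤ : ℕ∞) g →
          ∫ y, inner ℝ (Laplacian.laplacian U y - (α * ℓ ^ 2) • U y - (ℓ ^ 2 / 2) • (fderiv ℝ U y) y)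
              (g (P y + ‖U y‖ ^ 2 / 2) • curl U y) = 0) →
        U = 0 := by
  sorry

/-- **Stub 3 — WINDOW LAW with remainder bound (NS calculus in the eddy frame; the lead's stub).**
For a classical NS solution `(u, p)` on `[0, T)` (force `0`), a `C¹` divergence-free `U`, a test field
`φ ∈ C_c^∞` with `div φ = 0`, `tsupport φ ⊆ B_R`, lying in the cokernel at `U`
(`∫ ⟪U, Dφ·W⟫ + ⟪W, Dφ·U⟫ = 0` for all `C¹` divergence-free `W`), and a centre path `ξ` that is `C¹` on
`(T₀, T)`, `0 ≤ T₀ < T`: with `L(t) = ℓ√(ν(T−t))`, `V(t,y) = (T−t)^α u(t, ξ(t) + L(t)y)`,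
`𝓛*φ = ℓ⁻¹Δφ − αℓφ + (ℓ/2)(3φ + Dφ·y)`, the pairing `G(t) = ∫ ⟪V(t), φ⟫` is differentiable on `(T₀, T)`
with `G′(t) = q(t) + (ℓ(T−t))⁻¹ ∫ ⟪V(t), 𝓛*φ⟫`, where `q` and `t ↦ ∫ ⟪V(t), 𝓛*φ⟫` are continuous on
`(T₀, T)` and `|q(t)| ≤ K ρ(t)` with the quiet weight `ρ` of `stub_quietFrame` and a constant `K`
depending on `φ, R` only.  Exact form (not exported):
`q = (T−t)^{−α}/L · ∫ ⟪V−U, Dφ·(V−U)⟫ − L⁻¹ ∫ ⟪V−U, Dφ·ξ̇⟫`; derivation: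
`∂ₜV = −(A/L)[DV·V + ∇Q] + (ℓ(T−t))⁻¹[ℓ⁻¹ΔV − αℓV − (ℓ/2)DV·y] + L⁻¹DV·ξ̇` (`L̇/L = −1/(2(T−t))`,
`ν/L² = 1/(ℓ²(T−t))`); the pressure pairs to `0` (`div φ = 0`); `∫⟪DV·V, φ⟫ = −∫⟪V, Dφ·V⟫` and the
cokernel identity with `W := U` and `W := V(t) − U` leave only `∫⟪V−U, Dφ·(V−U)⟫`; the `U`-part of the
frame term vanishes by the cokernel identity with `W :=` a constant field; the drift is moved onto `φ`
by parts (`div y = 3`).  Bound: `‖Dφ‖_∞`, Cauchy–Schwarz on `B_R`.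
Uses: the classical equations on `(T₀,T) ⊂ (0,T)` (interior: honest time derivative), `div u = 0`,
smoothness; NOT Leray–Hopf, NOT decay, NOT the steady Euler equation (only through the cokernel
hypothesis), `α` arbitrary, `ℓ, ν > 0`.  Size: L.
Leans on: `IsClassicalNSSolutionOn.integral_inner_timeDerivWithin_test`,
`integral_inner_convect_add_eq_zero`, `integral_inner_laplacian_comm`,
`integral_inner_gradient_eq_neg_integral_mul_divergence`, `hasDerivAt_integral_of_dominated_loc_of_deriv_le`. -/
theorem stub_windowLaw :
    ∀ (ν T T₀ α ℓ R : ℝ) (u : ℝ → EuclideanSpace ℝ (Fin 3) → EuclideanSpace ℝ (Fin 3))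
      (p : ℝ → EuclideanSpace ℝ (Fin 3) → ℝ)
      (U φ : EuclideanSpace ℝ (Fin 3) → EuclideanSpace ℝ (Fin 3)) (ξ dξ : ℝ → EuclideanSpace ℝ (Fin 3)),
      0 < ν → 0 ≤ T₀ → T₀ < T → 0 < ℓ →
      IsClassicalNSSolutionOn (Set.Ico 0 T) ν 0 u p →
      ContDiff ℝ 1 U → VectorCalculus.IsDivFree U →
      ContDiff ℝ (⊤ : ℕ∞) φ → HasCompactSupport φ → VectorCalculus.IsDivFree φ →
      tsupport φ ⊆ Metric.ball 0 R →
      (∀ W : EuclideanSpace ℝ (Fin 3) → EuclideanSpace ℝ (Fin 3), ContDiff ℝ 1 W →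
        VectorCalculus.IsDivFree W →
        ∫ y, (inner ℝ (U y) (fderiv ℝ φ y (W y)) + inner ℝ (W y) (fderiv ℝ φ y (U y))) = 0) →
      (∀ t ∈ Set.Ioo T₀ T, HasDerivAt ξ (dξ t) t) → ContinuousOn dξ (Set.Ioo T₀ T) →
      ∃ (K : ℝ) (q : ℝ → ℝ), ContinuousOn q (Set.Ioo T₀ T) ∧
        ContinuousOn (fun t : ℝ => ∫ y, inner ℝ (((T - t) ^ α) • u t (ξ t + (ℓ * Real.sqrt (ν * (T - t))) • y))
          (ℓ⁻¹ • Laplacian.laplacian φ y - (α * ℓ) • φ y + (ℓ / 2) • ((3 : ℝ) • φ y + fderiv ℝ φ y y)))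
          (Set.Ioo T₀ T) ∧
        (∀ t ∈ Set.Ioo T₀ T, |q t| ≤ K *
          ((T - t) ^ (-α) / (ℓ * Real.sqrt (ν * (T - t))) *
              (∫ y in Metric.ball (0 : EuclideanSpace ℝ (Fin 3)) R,
                ‖((T - t) ^ α) • u t (ξ t + (ℓ * Real.sqrt (ν * (T - t))) • y) - U y‖ ^ 2) +
            ‖dξ t‖ / (ℓ * Real.sqrt (ν * (T - t))) *
              Real.sqrt (∫ y in Metric.ball (0 : EuclideanSpace ℝ (Fin 3)) R,
                ‖((T - t) ^ α) • u t (ξ t + (ℓ * Real.sqrt (ν * (T - t))) • y) - U y‖ ^ 2))) ∧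
        ∀ t ∈ Set.Ioo T₀ T,
          HasDerivAt (fun s : ℝ => ∫ y, inner ℝ (((T - s) ^ α) • u s (ξ s + (ℓ * Real.sqrt (ν * (T - s))) • y)) (φ y))
            (q t + (ℓ * (T - t))⁻¹ *
              ∫ y, inner ℝ (((T - t) ^ α) • u t (ξ t + (ℓ * Real.sqrt (ν * (T - t))) • y))
                (ℓ⁻¹ • Laplacian.laplacian φ y - (α * ℓ) • φ y + (ℓ / 2) • ((3 : ℝ) • φ y + fderiv ℝ φ y y)))
            t := by
  sorry

/-- **Stub 4 — LOG-WINDOW LEMMA (abstract real analysis).**  If `G` is bounded on `(T₀, T)` and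
differentiable there with `G′(t) = q(t) + (ℓ(T−t))⁻¹ c(t)`, where `q, c` are continuous on `(T₀, T)`,
`|q| ≤ K ρ` with `ρ` integrable on `(T₀, T)`, and `c(t) → c₀` as `t ↑ T`, then `c₀ = 0`: otherwise, for
`t₁ < t₂` late, `|G(t₂) − G(t₁)| ≥ (|c₀|/2) ℓ⁻¹ log((T−t₁)/(T−t₂)) − K ∫ρ → ∞` as `t₂ ↑ T`.
(FTC `intervalIntegral.integral_eq_sub_of_hasDerivAt` on `[t₁,t₂] ⊂ (T₀,T)`; the antiderivative of
`(T−t)⁻¹` is `−log(T−t)`; `Real.tendsto_log_atTop`-type divergence.)  Size: S–M. -/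
theorem stub_logWindow :
    ∀ (T₀ T ℓ c₀ K : ℝ) (G q c ρ : ℝ → ℝ), T₀ < T → 0 < ℓ →
      (∀ t ∈ Set.Ioo T₀ T, HasDerivAt G (q t + (ℓ * (T - t))⁻¹ * c t) t) →
      ContinuousOn q (Set.Ioo T₀ T) → ContinuousOn c (Set.Ioo T₀ T) →
      (∃ M : ℝ, ∀ t ∈ Set.Ioo T₀ T, |G t| ≤ M) →
      IntegrableOn ρ (Set.Ioo T₀ T) → (∀ t ∈ Set.Ioo T₀ T, |q t| ≤ K * ρ t) →
      Tendsto c (nhdsWithin T (Set.Iio T)) (nhds c₀) →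
      c₀ = 0 := by
  sorry

/-- **Stub 5 — PAIRING LIMIT (convergence toolkit).**  If `V(t) → U` locally uniformly on `ℝ³` as
`t ↑ T`, with `V(t)` continuous for `t` near `T` and `U` continuous, then for every continuous compactly
supported `ψ`, `∫ ⟪V(t), ψ⟫ → ∫ ⟪U, ψ⟫` as `t ↑ T` (uniform convergence on the compact `tsupport ψ`:
`TendstoLocallyUniformly` ⇒ `TendstoUniformlyOn` on compacts; then
`‖∫⟪V(t) − U, ψ⟫‖ ≤ sup_{tsupport ψ}‖V(t) − U‖ · ∫‖ψ‖`).  Size: S–M. -/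
theorem stub_pairingLimit :
    ∀ (T : ℝ) (V : ℝ → EuclideanSpace ℝ (Fin 3) → EuclideanSpace ℝ (Fin 3))
      (U ψ : EuclideanSpace ℝ (Fin 3) → EuclideanSpace ℝ (Fin 3)),
      TendstoLocallyUniformly V U (nhdsWithin T (Set.Iio T)) →
      (∀ᶠ t in nhdsWithin T (Set.Iio T), Continuous (V t)) → Continuous U →
      Continuous ψ → HasCompactSupport ψ →
      Tendsto (fun t : ℝ => ∫ y, inner ℝ (V t y) (ψ y)) (nhdsWithin T (Set.Iio T))
        (nhds (∫ y, inner ℝ (U y) (ψ y))) := by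
  sorry

/-- **Stub 6 — ENERGY COKERNEL FAMILY (Euler-side algebra + integration by parts).**  For a smooth
compactly supported steady Euler flow `(U, P)` and smooth `f : ℝ → ℝ`, the field
`φ_f = f(B) U`, `B = P + |U|²/2` (Bernoulli head), is smooth, compactly supported (inside `tsupport U`), divergence free
(`div φ_f = f′(B) U·∇B = 0` since `∇B = U × curl U ⊥ U`, from `DU·U + ∇P = 0`), and lies in the cokernel of
the linearised steady Euler operator at `U`: for EVERY `C¹` divergence-free `W` (no decay needed),
`∫ (⟪U, Dφ_f·W⟫ + ⟪W, Dφ_f·U⟫) = 0`.  Proof: by parts (`integral_inner_convect_add_eq_zero`) the left side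
is `−∫ ⟪DU·W + DW·U, f(B)U⟫ = −∫ f(B) ⟪W, ∇B⟫ = −∫ ⟪W, ∇(F∘B)⟫`, `F′ = f`, and `F∘B` minus its value at
infinity is a compactly supported `C¹` scalar (its gradient `f(B)∇B` is supported in `tsupport U` and
`ℝ³ ∖ ball` is connected), so `IsDivFree.isWeaklyDivFree_holds` ends it.  Size: M–L. -/
theorem stub_cokernelEnergy :
    ∀ (U : EuclideanSpace ℝ (Fin 3) → EuclideanSpace ℝ (Fin 3)) (P : EuclideanSpace ℝ (Fin 3) → ℝ)
      (f : ℝ → ℝ),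
      ContDiff ℝ (⊤ : ℕ∞) U → ContDiff ℝ (⊤ : ℕ∞) P → HasCompactSupport U →
      VectorCalculus.IsDivFree U → (∀ x, convect U U x + gradient P x = 0) → ContDiff ℝ (⊤ : ℕ∞) f →
      ContDiff ℝ (⊤ : ℕ∞) (fun y => f (P y + ‖U y‖ ^ 2 / 2) • U y) ∧
        HasCompactSupport (fun y => f (P y + ‖U y‖ ^ 2 / 2) • U y) ∧
        tsupport (fun y => f (P y + ‖U y‖ ^ 2 / 2) • U y) ⊆ tsupport U ∧
        VectorCalculus.IsDivFree (fun y => f (P y + ‖U y‖ ^ 2 / 2) • U y) ∧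
        ∀ W : EuclideanSpace ℝ (Fin 3) → EuclideanSpace ℝ (Fin 3), ContDiff ℝ 1 W →
          VectorCalculus.IsDivFree W →
          ∫ y, (inner ℝ (U y) (fderiv ℝ (fun z => f (P z + ‖U z‖ ^ 2 / 2) • U z) y (W y)) +
            inner ℝ (W y) (fderiv ℝ (fun z => f (P z + ‖U z‖ ^ 2 / 2) • U z) y (U y))) = 0 := by
  sorry

/-- **Stub 7 — HELICITY COKERNEL FAMILY (Euler-side algebra + integration by parts).**  Same for
`ψ_g = g(B) curl U`: smooth, compactly supported (inside `tsupport U`), divergence free (`div curl = 0`, `curl U · ∇B = 0`), and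
`∫ (⟪U, Dψ_g·W⟫ + ⟪W, Dψ_g·U⟫) = 0` for every `C¹` divergence-free `W`.  Proof: by parts the left side is
`−∫ g(B) ⟪DW·U + DU·W, ω⟫`, `ω = curl U`; move `D` off `W` in the first term along `U` (`div U = 0`,
`U·∇(g∘B) = 0`) to get `∫ g(B) ⟪W, Dω·U⟫`; the steady vorticity equation `Dω·U = DU·ω` (curl of
`DU·U + ∇P = 0`) and `⟪DU·W, ω⟫ − ⟪W, DU·ω⟫ = ⟪W, (DUᵀ − DU)ω⟫ = −⟪W, ω × ω⟫ = 0` finish.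
Size: L (vector identities on `EuclideanSpace ℝ (Fin 3)` componentwise). -/
theorem stub_cokernelHelicity :
    ∀ (U : EuclideanSpace ℝ (Fin 3) → EuclideanSpace ℝ (Fin 3)) (P : EuclideanSpace ℝ (Fin 3) → ℝ)
      (g : ℝ → ℝ),
      ContDiff ℝ (⊤ : ℕ∞) U → ContDiff ℝ (⊤ : ℕ∞) P → HasCompactSupport U →
      VectorCalculus.IsDivFree U → (∀ x, convect U U x + gradient P x = 0) → ContDiff ℝ (⊤ : ℕ∞) g →
      ContDiff ℝ (⊤ : ℕ∞) (fun y => g (P y + ‖U y‖ ^ 2 / 2) • curl U y) ∧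
        HasCompactSupport (fun y => g (P y + ‖U y‖ ^ 2 / 2) • curl U y) ∧
        tsupport (fun y => g (P y + ‖U y‖ ^ 2 / 2) • curl U y) ⊆ tsupport U ∧
        VectorCalculus.IsDivFree (fun y => g (P y + ‖U y‖ ^ 2 / 2) • curl U y) ∧
        ∀ W : EuclideanSpace ℝ (Fin 3) → EuclideanSpace ℝ (Fin 3), ContDiff ℝ 1 W →
          VectorCalculus.IsDivFree W →
          ∫ y, (inner ℝ (U y) (fderiv ℝ (fun z => g (P z + ‖U z‖ ^ 2 / 2) • curl U z) y (W y)) +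
            inner ℝ (W y) (fderiv ℝ (fun z => g (P z + ‖U z‖ ^ 2 / 2) • curl U z) y (U y))) = 0 := by
  sorry

/-! ### Sorry-free glue: the adjoint identity `⟨U, 𝓛*φ⟩ = ℓ⁻¹ ⟨𝓛̃U, φ⟩` -/

section Adjoint

local notation "E3" => EuclideanSpace ℝ (Fin 3)

/-- The divergence of the identity field `y ↦ y` on `ℝ³` is `3`. -/
theorem divergence_id_eq_three (y : E3) :
    VectorCalculus.divergence (fun z : E3 => z) y = 3 := by
  rw [VectorCalculus.divergence]
  have : (fderiv ℝ (fun z : E3 => z) y : E3 →ₗ[ℝ] E3) = LinearMap.id := by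
    rw [show (fun z : E3 => z) = id from rfl, fderiv_id]; rfl
  rw [this, LinearMap.trace_id, finrank_euclideanSpace_fin]
  norm_num

/-- The adjoint drift field `𝓛*φ = ℓ⁻¹Δφ − αℓφ + (ℓ/2)(3φ + Dφ·y)` of a `C²` compactly supported `φ` is
continuous. -/
theorem continuous_adjointDrift {α ℓ : ℝ} {φ : E3 → E3} (hφ : ContDiff ℝ 2 φ) :
    Continuous (fun y => ℓ⁻¹ • Laplacian.laplacian φ y - (α * ℓ) • φ y +
      (ℓ / 2) • ((3 : ℝ) • φ y + fderiv ℝ φ y y)) := by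
  have h1 : Continuous (fun y => Laplacian.laplacian φ y) := continuous_laplacian hφ
  have h2 : Continuous φ := hφ.continuous
  have h3 : Continuous (fun y => fderiv ℝ φ y y) :=
    (hφ.continuous_fderiv two_ne_zero).clm_apply continuous_id
  exact ((h1.const_smul ℓ⁻¹).sub (h2.const_smul (α * ℓ))).add
    (((h2.const_smul (3 : ℝ)).add h3).const_smul (ℓ / 2))

/-- The adjoint drift field of a compactly supported `φ` is compactly supported (in `tsupport φ`). -/
theorem hasCompactSupport_adjointDrift {α ℓ : ℝ} {φ : E3 → E3} (hc : HasCompactSupport φ) :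
    HasCompactSupport (fun y => ℓ⁻¹ • Laplacian.laplacian φ y - (α * ℓ) • φ y +
      (ℓ / 2) • ((3 : ℝ) • φ y + fderiv ℝ φ y y)) := by
  refine HasCompactSupport.intro hc fun y hy => ?_
  simp [laplacian_eq_zero_of_notMem_tsupport hy, image_eq_zero_of_notMem_tsupport hy,
    fderiv_of_notMem_tsupport ℝ hy]

/-- **Adjoint identity** `∫ ⟪U, 𝓛*φ⟫ = ℓ⁻¹ ∫ ⟪ΔU − αℓ²U − (ℓ²/2) DU·y, φ⟫` for `U ∈ C²` and
`φ ∈ C²_c` (Laplacian symmetric against compactly supported fields; `∫⟪DU·y, φ⟫ + ∫⟪U, Dφ·y⟫ + 3∫⟪U, φ⟫ = 0`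
by the trilinear identity with the field `y ↦ y`, `div y = 3`). -/
theorem integral_inner_adjointDrift {α ℓ : ℝ} {U φ : E3 → E3} (hℓ : ℓ ≠ 0)
    (hU : ContDiff ℝ 2 U) (hφ : ContDiff ℝ 2 φ) (hc : HasCompactSupport φ) :
    ∫ y, inner ℝ (U y) (ℓ⁻¹ • Laplacian.laplacian φ y - (α * ℓ) • φ y +
        (ℓ / 2) • ((3 : ℝ) • φ y + fderiv ℝ φ y y)) =
      ℓ⁻¹ * ∫ y, inner ℝ (Laplacian.laplacian U y - (α * ℓ ^ 2) • U y - (ℓ ^ 2 / 2) • (fderiv ℝ U y) y)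
        (φ y) := by
  have hU1 : ContDiff ℝ 1 U := hU.of_le one_le_two
  have hφ1 : ContDiff ℝ 1 φ := hφ.of_le one_le_two
  have hUc : Continuous U := hU.continuous
  have hφc : Continuous φ := hφ.continuous
  -- integrability of the pieces (right factor compactly supported)
  have iL : Integrable (fun y => inner ℝ (U y) (Laplacian.laplacian φ y)) (volume : Measure E3) :=
    integrable_inner_of_hasCompactSupport_right hUc (continuous_laplacian hφ)
      (hc.mono' fun x hx => by
        contrapose! hx; simp [laplacian_eq_zero_of_notMem_tsupport hx])
  have iP : Integrable (fun y => inner ℝ (U y) (φ y)) (volume : Measure E3) :=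
    integrable_inner_of_hasCompactSupport_right hUc hφc hc
  have iD : Integrable (fun y => inner ℝ (U y) (fderiv ℝ φ y y)) (volume : Measure E3) :=
    integrable_inner_of_hasCompactSupport_right hUc
      ((hφ.continuous_fderiv two_ne_zero).clm_apply continuous_id)
      ((hc.fderiv (𝕜 := ℝ)).mono fun x hx => by
        contrapose! hx; simp only [mem_support, not_not] at hx; simp [hx])
  have iL' : Integrable (fun y => inner ℝ (Laplacian.laplacian U y) (φ y)) (volume : Measure E3) :=
    integrable_inner_of_hasCompactSupport_right (continuous_laplacian hU) hφc hc
  have iD' : Integrable (fun y => inner ℝ ((fderiv ℝ U y) y) (φ y)) (volume : Measure E3) :=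
    integrable_inner_of_hasCompactSupport_right
      ((hU.continuous_fderiv two_ne_zero).clm_apply continuous_id) hφc hc
  -- Laplacian symmetry
  have eL : ∫ y, inner ℝ (U y) (Laplacian.laplacian φ y) =
      ∫ y, inner ℝ (Laplacian.laplacian U y) (φ y) :=
    (integral_inner_laplacian_comm hU hφ hc).symm
  -- dilation: trilinear identity with the identity field
  have eD : (∫ y, inner ℝ ((fderiv ℝ U y) y) (φ y)) + (∫ y, inner ℝ (U y) (fderiv ℝ φ y y)) +
      3 * ∫ y, inner ℝ (U y) (φ y) = 0 := by
    have h := integral_inner_convect_add_eq_zero (u := fun z : E3 => z) (v := U) (w := φ)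
      contDiff_id hU1 hφ1 hc
    simp only [convect, divergence_id_eq_three] at h
    rw [integral_const_mul] at h
    exact h
  -- expand both sides
  have key : ∀ y, inner ℝ (U y) (ℓ⁻¹ • Laplacian.laplacian φ y - (α * ℓ) • φ y +
      (ℓ / 2) • ((3 : ℝ) • φ y + fderiv ℝ φ y y)) =
      (ℓ⁻¹ * inner ℝ (U y) (Laplacian.laplacian φ y) - (α * ℓ) * inner ℝ (U y) (φ y)) +
        (ℓ / 2) * (3 * inner ℝ (U y) (φ y) + inner ℝ (U y) (fderiv ℝ φ y y)) := by
    intro y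
    simp only [inner_add_right, inner_sub_right, inner_smul_right]
  have key' : ∀ y, inner ℝ (Laplacian.laplacian U y - (α * ℓ ^ 2) • U y - (ℓ ^ 2 / 2) • (fderiv ℝ U y) y)
      (φ y) = (inner ℝ (Laplacian.laplacian U y) (φ y) - (α * ℓ ^ 2) * inner ℝ (U y) (φ y)) -
        (ℓ ^ 2 / 2) * inner ℝ ((fderiv ℝ U y) y) (φ y) := by
    intro y
    simp only [inner_sub_left, inner_smul_left, RCLike.conj_to_real]
  simp_rw [key, key']
  have lhs : ∫ y, ((ℓ⁻¹ * inner ℝ (U y) (Laplacian.laplacian φ y) - (α * ℓ) * inner ℝ (U y) (φ y)) +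
      (ℓ / 2) * (3 * inner ℝ (U y) (φ y) + inner ℝ (U y) (fderiv ℝ φ y y))) =
      (ℓ⁻¹ * (∫ y, inner ℝ (U y) (Laplacian.laplacian φ y)) - (α * ℓ) * ∫ y, inner ℝ (U y) (φ y)) +
        (ℓ / 2) * (3 * (∫ y, inner ℝ (U y) (φ y)) + ∫ y, inner ℝ (U y) (fderiv ℝ φ y y)) := by
    rw [integral_add, integral_sub, integral_const_mul, integral_const_mul, integral_const_mul,
      integral_add, integral_const_mul]
    all_goals first
      | exact iD
      | exact iL.const_mul _
      | exact iP.const_mul _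
      | exact (iL.const_mul _).sub (iP.const_mul _)
      | exact (iP.const_mul _).add iD
      | exact ((iP.const_mul _).add iD).const_mul _
  have rhs : ∫ y, ((inner ℝ (Laplacian.laplacian U y) (φ y) - (α * ℓ ^ 2) * inner ℝ (U y) (φ y)) -
      (ℓ ^ 2 / 2) * inner ℝ ((fderiv ℝ U y) y) (φ y)) =
      ((∫ y, inner ℝ (Laplacian.laplacian U y) (φ y)) - (α * ℓ ^ 2) * ∫ y, inner ℝ (U y) (φ y)) -
        (ℓ ^ 2 / 2) * ∫ y, inner ℝ ((fderiv ℝ U y) y) (φ y) := by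
    rw [integral_sub, integral_sub, integral_const_mul, integral_const_mul]
    all_goals first
      | exact iL'
      | exact iP.const_mul _
      | exact iD'.const_mul _
      | exact iL'.sub (iP.const_mul _)
  rw [lhs, rhs, eL]
  set X := ∫ y, inner ℝ (Laplacian.laplacian U y) (φ y) with hX
  set A := ∫ y, inner ℝ ((fderiv ℝ U y) y) (φ y) with hA
  set B := ∫ y, inner ℝ (U y) (fderiv ℝ φ y y) with hB
  set C := ∫ y, inner ℝ (U y) (φ y) with hC
  have hinv : ℓ * ℓ⁻¹ = 1 := mul_inv_cancel₀ hℓ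
  linear_combination (ℓ / 2) * eD + (α * ℓ * C + ℓ / 2 * A) * hinv

end Adjoint

/-! ### Composition (kernel-checked, no `sorry` below this line except through the stubs) -/

section Composition

local notation "E3" => EuclideanSpace ℝ (Fin 3)

/-- **One cokernel direction on a quiet frame gives one shell balance.**  Data: a classical solution,
a smooth compactly supported `U` (only `C²` and compact support are used here), `α`, `ℓ > 0`, a `C¹`
frame `ξ'` on `(T₀, T)` along which `V' → U` locally uniformly and the quiet weight is integrable, and a
cokernel test field `φ` (smooth, compactly supported, divergence free, cokernel identity).  Conclusion:
`∫ ⟪ΔU − αℓ²U − (ℓ²/2)DU·y, φ⟫ = 0`.  Proof: `stub_windowLaw` (derivative + remainder bound),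
`stub_pairingLimit` twice (boundedness of `G`, limit of `c`), `stub_logWindow`, `integral_inner_adjointDrift`. -/
theorem shellBalance_of_quietFrame {ν T T₀ α ℓ R : ℝ} {u : ℝ → E3 → E3} {p : ℝ → E3 → ℝ}
    {U φ : E3 → E3} {ξ' dξ' : ℝ → E3}
    (hν : 0 < ν) (hT₀ : 0 ≤ T₀) (hT₀T : T₀ < T) (hℓ : 0 < ℓ)
    (hns : IsClassicalNSSolutionOn (Set.Ico 0 T) ν 0 u p)
    (hU : ContDiff ℝ (⊤ : ℕ∞) U) (hUc : HasCompactSupport U) (hUdiv : VectorCalculus.IsDivFree U)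
    (hφ : ContDiff ℝ (⊤ : ℕ∞) φ) (hφc : HasCompactSupport φ) (hφdiv : VectorCalculus.IsDivFree φ)
    (hφR : tsupport φ ⊆ Metric.ball 0 R)
    (hcok : ∀ W : E3 → E3, ContDiff ℝ 1 W → VectorCalculus.IsDivFree W →
      ∫ y, (inner ℝ (U y) (fderiv ℝ φ y (W y)) + inner ℝ (W y) (fderiv ℝ φ y (U y))) = 0)
    (hder : ∀ t ∈ Set.Ioo T₀ T, HasDerivAt ξ' (dξ' t) t) (hdξ : ContinuousOn dξ' (Set.Ioo T₀ T))
    (hconv : TendstoLocallyUniformly (fun (t : ℝ) (y : E3) =>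
      ((T - t) ^ α) • u t (ξ' t + (ℓ * Real.sqrt (ν * (T - t))) • y)) U (nhdsWithin T (Set.Iio T)))
    (hquiet : IntegrableOn (fun t : ℝ =>
      (T - t) ^ (-α) / (ℓ * Real.sqrt (ν * (T - t))) *
          (∫ y in Metric.ball (0 : E3) R,
            ‖((T - t) ^ α) • u t (ξ' t + (ℓ * Real.sqrt (ν * (T - t))) • y) - U y‖ ^ 2) +
        ‖dξ' t‖ / (ℓ * Real.sqrt (ν * (T - t))) *
          Real.sqrt (∫ y in Metric.ball (0 : E3) R,
            ‖((T - t) ^ α) • u t (ξ' t + (ℓ * Real.sqrt (ν * (T - t))) • y) - U y‖ ^ 2))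
      (Set.Ioo T₀ T)) :
    ∫ y, inner ℝ (Laplacian.laplacian U y - (α * ℓ ^ 2) • U y - (ℓ ^ 2 / 2) • (fderiv ℝ U y) y)
      (φ y) = 0 := by
  -- the rescaled field and the adjoint test field
  set V : ℝ → E3 → E3 := fun t y => ((T - t) ^ α) • u t (ξ' t + (ℓ * Real.sqrt (ν * (T - t))) • y)
    with hV
  set adj : E3 → E3 := fun y => ℓ⁻¹ • Laplacian.laplacian φ y - (α * ℓ) • φ y +
    (ℓ / 2) • ((3 : ℝ) • φ y + fderiv ℝ φ y y) with hadj
  have hφ2 : ContDiff ℝ 2 φ := contDiff_infty.1 hφ 2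
  have hU2 : ContDiff ℝ 2 U := contDiff_infty.1 hU 2
  have hU1 : ContDiff ℝ 1 U := contDiff_infty.1 hU 1
  have hadjc : Continuous adj := continuous_adjointDrift hφ2
  have hadjs : HasCompactSupport adj := hasCompactSupport_adjointDrift hφc
  -- window law
  obtain ⟨K, q, hqc, hcc, hqb, hG⟩ := stub_windowLaw ν T T₀ α ℓ R u p U φ ξ' dξ' hν hT₀ hT₀T hℓ hns
    hU1 hUdiv hφ hφc hφdiv hφR hcok hder hdξ
  -- continuity of the slices `V t` for `t ∈ (T₀, T)`
  have hVcont : ∀ t ∈ Set.Ioo T₀ T, Continuous (V t) := by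
    intro t ht
    have hut : Continuous (u t) := (hns.contDiff_velocity ⟨hT₀.trans ht.1.le, ht.2⟩).continuous
    have h1 : Continuous (fun y : E3 => ξ' t + (ℓ * Real.sqrt (ν * (T - t))) • y) := by fun_prop
    simp only [hV]
    exact (hut.comp h1).const_smul ((T - t) ^ α)
  have hVev : ∀ᶠ t in nhdsWithin T (Set.Iio T), Continuous (V t) := by
    have : Set.Ioo T₀ T ∈ nhdsWithin T (Set.Iio T) := Ioo_mem_nhdsLT hT₀T
    exact Filter.mem_of_superset this fun t ht => hVcont t ht
  -- limits of the two pairings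
  have hlimG : Tendsto (fun t : ℝ => ∫ y, inner ℝ (V t y) (φ y)) (nhdsWithin T (Set.Iio T))
      (nhds (∫ y, inner ℝ (U y) (φ y))) :=
    stub_pairingLimit T V U φ hconv hVev hU.continuous hφ.continuous hφc
  have hlimc : Tendsto (fun t : ℝ => ∫ y, inner ℝ (V t y) (adj y)) (nhdsWithin T (Set.Iio T))
      (nhds (∫ y, inner ℝ (U y) (adj y))) :=
    stub_pairingLimit T V U adj hconv hVev hU.continuous hadjc hadjs
  -- `G` is bounded on a late window `(T₁, T)`
  obtain ⟨T₁, hT₁, hGbd⟩ : ∃ T₁, T₀ ≤ T₁ ∧ T₁ < T ∧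
      ∀ t ∈ Set.Ioo T₁ T, |∫ y, inner ℝ (V t y) (φ y)| ≤ |∫ y, inner ℝ (U y) (φ y)| + 1 := by
    have h1 : ∀ᶠ t in nhdsWithin T (Set.Iio T),
        |∫ y, inner ℝ (V t y) (φ y)| ≤ |∫ y, inner ℝ (U y) (φ y)| + 1 := by
      have hball : Metric.ball (∫ y, inner ℝ (U y) (φ y)) 1 ∈ nhds (∫ y, inner ℝ (U y) (φ y)) :=
        Metric.ball_mem_nhds _ one_pos
      filter_upwards [hlimG hball] with t ht
      have : dist (∫ y, inner ℝ (V t y) (φ y)) (∫ y, inner ℝ (U y) (φ y)) < 1 := ht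
      rw [Real.dist_eq] at this
      have := abs_sub_abs_le_abs_sub (∫ y, inner ℝ (V t y) (φ y)) (∫ y, inner ℝ (U y) (φ y))
      linarith
    have h2 : ∀ᶠ t in nhdsWithin T (Set.Iio T), t ∈ Set.Ioo T₀ T := Ioo_mem_nhdsLT hT₀T
    obtain ⟨T₁', hT₁'T, hsub⟩ := mem_nhdsLT_iff_exists_Ioo_subset.1 (h1.and h2)
    refine ⟨max T₀ T₁', le_max_left _ _, max_lt hT₀T hT₁'T, fun t ht => ?_⟩
    exact (hsub ⟨(le_max_right _ _).trans_lt ht.1, ht.2⟩).1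
  have hT₁T : T₁ < T := hGbd.1
  have hsub₁ : Set.Ioo T₁ T ⊆ Set.Ioo T₀ T := Ioo_subset_Ioo_left hT₁
  -- log-window lemma on `(T₁, T)`
  have hc0 : ∫ y, inner ℝ (U y) (adj y) = 0 := by
    refine stub_logWindow T₁ T ℓ (∫ y, inner ℝ (U y) (adj y)) K
      (fun t => ∫ y, inner ℝ (V t y) (φ y)) q (fun t => ∫ y, inner ℝ (V t y) (adj y))
      (fun t => (T - t) ^ (-α) / (ℓ * Real.sqrt (ν * (T - t))) *
          (∫ y in Metric.ball (0 : E3) R, ‖V t y - U y‖ ^ 2) +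
        ‖dξ' t‖ / (ℓ * Real.sqrt (ν * (T - t))) *
          Real.sqrt (∫ y in Metric.ball (0 : E3) R, ‖V t y - U y‖ ^ 2))
      hT₁T hℓ (fun t ht => hG t (hsub₁ ht)) (hqc.mono hsub₁) (hcc.mono hsub₁)
      ⟨_, hGbd.2⟩ (hquiet.mono_set hsub₁) (fun t ht => hqb t (hsub₁ ht)) hlimc
  -- adjoint identity
  have hadjI := integral_inner_adjointDrift (α := α) hℓ.ne' hU2 hφ2 hφc
  rw [hc0] at hadjI
  have hℓi : ℓ⁻¹ ≠ 0 := inv_ne_zero hℓ.ne'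
  exact (mul_eq_zero.1 hadjI.symm).resolve_left hℓi

/-- **Composition of the line — the crux from the seven stubs** (kernel-checked; no `sorry` of its own).
By contradiction: if `U ≠ 0`, `stub_quietFrame` gives a quiet `C¹` frame; `shellBalance_of_quietFrame`
applied to the two cokernel families (`stub_cokernelEnergy`, `stub_cokernelHelicity`) gives the energy and
helicity shell balances for all smooth `f, g`; `stub_noShellBalance` gives `U = 0`.  This theorem concludes
`Summit.NavierStokesRegularity.NavierStokesRegularity.Theses.AdiabaticEddy.NoFrozenEddyCollapse` BY NAME. -/
theorem NoFrozenEddyCollapse_of :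
    Summit.NavierStokesRegularity.NavierStokesRegularity.Theses.AdiabaticEddy.NoFrozenEddyCollapse := by
  intro ν hν T hT u p hns hLH hdec U P hU hP hUc hUdiv hE α hα ℓ hℓ ξ hconv
  by_contra hne
  obtain ⟨T₀, R, ξ', dξ', hT₀, hT₀T, hder, hdξ, hconv', hR, hquiet⟩ :=
    stub_quietFrame ν T u p U P α ℓ ξ hν hT hns hLH hdec hU hP hUc hUdiv hE hne hα hℓ hconv
  have hEbal : ∀ f : ℝ → ℝ, ContDiff ℝ (⊤ : ℕ∞) f →
      ∫ y, inner ℝ (Laplacian.laplacian U y - (α * ℓ ^ 2) • U y - (ℓ ^ 2 / 2) • (fderiv ℝ U y) y)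
        (f (P y + ‖U y‖ ^ 2 / 2) • U y) = 0 := by
    intro f hf
    obtain ⟨hφ, hφc, hφU, hφdiv, hcok⟩ := stub_cokernelEnergy U P f hU hP hUc hUdiv hE hf
    have hφR : tsupport (fun y => f (P y + ‖U y‖ ^ 2 / 2) • U y) ⊆ Metric.ball 0 R := hφU.trans hR
    exact shellBalance_of_quietFrame hν hT₀ hT₀T hℓ hns hU hUc hUdiv hφ hφc hφdiv hφR hcok hder hdξ
      hconv' hquiet
  have hHbal : ∀ g : ℝ → ℝ, ContDiff ℝ (⊤ : ℕ∞) g →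
      ∫ y, inner ℝ (Laplacian.laplacian U y - (α * ℓ ^ 2) • U y - (ℓ ^ 2 / 2) • (fderiv ℝ U y) y)
        (g (P y + ‖U y‖ ^ 2 / 2) • curl U y) = 0 := by
    intro g hg
    obtain ⟨hψ, hψc, hψU, hψdiv, hcok⟩ := stub_cokernelHelicity U P g hU hP hUc hUdiv hE hg
    have hψR : tsupport (fun y => g (P y + ‖U y‖ ^ 2 / 2) • curl U y) ⊆ Metric.ball 0 R :=
      hψU.trans hR
    exact shellBalance_of_quietFrame hν hT₀ hT₀T hℓ hns hU hUc hUdiv hψ hψc hψdiv hψR hcok hder hdξ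
      hconv' hquiet
  exact hne (stub_noShellBalance α hα ℓ hℓ U P hU hP hUc hUdiv hE hEbal hHbal)

end Composition

end Summit.NavierStokesRegularity.NavierStokesRegularity.Cruxes.NoFrozenEddyCollapse.ShellBalanceEdgeTorsion
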